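import Literature.MathematicalPhysics.QuantumFieldTheory.Balaban1983to89.B1Eq324BenfattoSect5CondToFree
import Literature.MathematicalPhysics.QuantumFieldTheory.Balaban1983to89.B1Eq324BenfattoSect5Eq524
import HarnessLib

/-!
# `Balaban1983to89.B1Eq324BenfattoSect5LegGeometry` — [BenfattoEtAl1978] §5 p. 153 / p. 157: the CORRIDOR GEOMETRY that makes the
# conditioned expectations «differ very little from the unconditional ones if Δ₁,…,Δ_p are far from the region ⋃(∂□)» — `ℓ¹` separations of
# the core from the corridors, the decay supplier `η` of `…Sect5CondToFree` at those separations, and the VOLUME-UNIFORM (Markov-localised)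
# bound on the conditional centre inside a box

statement-level skeleton of published theorems with citation tags; proofs where landed; nothing here is a claim about the
Yang–Mills mass gap

WHY THIS MODULE (cell `pub-ymgap`, seat `dag-n08-d` gen 9, INTENT-27; node N08 [Balaban1985UV3]; the [BenfattoEtAl1978] source chain behind the
(α)-row `h324c`).  Seat n08-b's `…Sect5CondToFree` (p544502) proves (5.31)'s «(error)» with the smallness `ε` of the conditional centre
`u = condMean` and of `C − C^Γ` on the legs as HYPOTHESES, supplied through (C.7) by a bound `η` on the Dirichlet covariance from the leg to the
neighbours of `Γ`; its HONEST SCOPE: *«The GEOMETRY turning §3's η into e^{−δ·dist(legs, Γ)} (distances from the deep box □′ to Γ₁(□) across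
Γ₂(□), width b^{3/2}) is the boxes line's»*; n08-b's census `N08-BCG-ASSEMBLY-MAP.md` v1 item 2: *«Corridor geometry: ℓ¹/ρ-distances between
□′∖Γ₄(□) and Γ₂(□) (≥ b^{3/2}/2) and between □′ and Γ₁(□); intra-cluster ℓ¹ vs connLength»*.  This file is that geometry, on the objects of
`…Sect5Boxes`/`…Sect5Eq524` (tessera `box L m`, `shrink L m k` = the sites at depth `≥ k`, `Γ₁(□) = frame1 = box ∖ shrink w`,
`□′ = shrink 2w`, `□′∖Γ₄(□) = shrink (2w+v)`, `Γ₁ = corridors L w B`).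
Print p. 153 (render `lit-balaban/inprint/lit-balaban-type-B10/benfatto1978-cmp59/bcg_p153.png`): *"Such expectations are polynomials in the z̄
and differ very little from the ones we want (i.e. the unconditional ones) if Δ₁,…,Δ_p are far from the region ⋃_□(∂□) because the covariance
of the z_Δ's decays exponentially and, far from ⋃_□(∂□), coincides with the unconditional covariance."*

WHAT IS PROVED (standard axioms; no `sorry`; no definition; `α, β > 0`; `θ = 2d/(2d + α²)`, `C₀₀ = freeCov d α β 0 0`).
* §1 `ℓ¹` GEOMETRY OF THE FRAMES (the `ℓ¹` distance written `Σ_j |x_j − y_j|` as in `…AppendixDWick` §5): `le_l1_of_mem_shrink_of_not_mem_shrink`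
  (depth `≥ j+v` vs depth `< j`: `ℓ¹ ≥ v + 1`), `le_l1_of_mem_shrink_of_not_mem_box` (`shrink k` vs outside `□`: `ℓ¹ ≥ k + 1`), ★ the instances
  App. D / (5.29) need: `le_l1_core_sdiff_frame4_of_not_mem_core` (a leg of `Ψ″₁` in `□′∖Γ₄(□)` vs a leg of `Ψ₂` in `Γ₁(□)∪Γ₂(□)`:
  `ℓ¹ ≥ v + 1`, print `v = ½b^{3/2}`), `le_l1_core_of_mem_corridors` (`□′` vs `Γ₁`: `ℓ¹ ≥ w + 1`); ★ «intra-cluster ℓ¹ vs connLength»: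
  `l1_le_sqrt_mul_cubeDist_add` (`ℓ¹(x,y) ≤ √d·cubeDist(x,y) + d`), `l1_le_sqrt_mul_connLength_add` (two tesserae of one tuple:
  `ℓ¹ ≤ √d·d(Δ₁…Δ_p) + d`).
* §2 THE SUPPLIER `η` AT DEPTH: `decayRatio_nonneg`/`decayRatio_le_one` (`0 ≤ θ ≤ 1`), `freeCov_le_of_le_l1` (`C(x,y) ≤ C₀₀θ^n` when
  `n ≤ ℓ¹(x,y)`; private plumbing: `ℓ¹` as a `natAbs` sum, `ℓ¹(x, c ± e_μ) ≥ ℓ¹(x,c) − 1`), ★ `freeCov_nbr_le_of_mem_shrink` (`x` at depth `≥ w + k`, `c` at depth `< w` ⇒ `C(x, c ± e_μ) ≤ C₀₀θ^k`), `condCov_nbrs_le_of_mem_shrink` (the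
  hypothesis `hη` of `…Sect5CondToFree.abs_condMean_le_of_condCov_le` DISCHARGED with `η = C₀₀θ^k` for `Γ ∩ (□′∪Γ₂(□)) = ∅`).
* §3 ★★ THE VOLUME-UNIFORM CENTRE BOUND (Markov localisation + (C.7) + (C.2)): `nbr_mem_box_of_mem_shrink`, `mem_frame1_of_adjacent`,
  ★ `condMean_eq_condMean_frame1` (for `Γ ⊇ Γ₁(□)` missing `□′∪Γ₂(□)` and `x ∈ □′∪Γ₂(□)`, `u(x)` depends on `z̄` only through `z̄|Γ₁(□)` —
  `…Markov.condMean_freeCov_congr_of_enclosed` + `…Sect5Boxes.shrink_enclosed`), ★★ `abs_condMean_le_of_mem_shrink` :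
  `|u(x)| ≤ β·(2d·C₀₀θ^k)·Σ_{c∈Γ₁(□)}|z̄_c|` for `x` at depth `≥ w + k` — the sum runs over the box's OWN outer corridor only (print's
  «decays exponentially», uniform in `|I|`), `abs_condMean_le_of_mem_shrink'` (`… ≤ β·2d·C₀₀·θ^k·L^d·M` for `|z̄| ≤ M` on `Γ₁(□)`), and on
  print's corridors `Γ₁ = corridors L w B`: `abs_condMean_corridors_le_core` (`x ∈ □′`, `k = w`), `abs_condMean_corridors_le_deep` (`x ∈ □′∖Γ₄(□)`,
  `k = w + v`).
* §4 ★★ THE COVARIANCE COINCIDES UP TO `θ^k`: `sum_freeCov_le` (`Σ_{c∈Γ}C(c,y) ≤ 1/(α²β)`, (C.5)), ★ `abs_freeCov_sub_condCov_le_of_mem_shrink`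
  (`|C(x,y) − C^Γ(x,y)| ≤ 2d·C₀₀·θ^k/α²` for `x` at depth `≥ w + k`, ANY `y`), and the `corridors` instances.
HONEST SCOPE.  Geometry and the two ε-suppliers only; the (5.31) error bound itself is `…Sect5CondToFree.abs_ursellOf_condField_sub_P0_le` (n08-b),
the assembly (5.30)–(5.35) is not here; count-neutral for N08; `BasicLemmaPrinted` NOT discharged; nothing about d = 4, the continuum, OS axioms,
a mass gap or the Clay problem.
-/

noncomputable section

open Finset
open scoped BigOperators

namespace Literature.MathematicalPhysics.QuantumFieldTheory.Balaban1983to89.B1Eq324BenfattoSect5LegGeometry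

open Literature.MathematicalPhysics.QuantumFieldTheory.Balaban1983to89.B3Sect3VectorSelfEnergy (ZSite unitVec)
open Literature.MathematicalPhysics.QuantumFieldTheory.Balaban1983to89.B1Eq324BenfattoLemma
open Literature.MathematicalPhysics.QuantumFieldTheory.Balaban1983to89.B1Eq324BenfattoConnLength
open Literature.MathematicalPhysics.QuantumFieldTheory.Balaban1983to89.B1Eq324BenfattoSect5Boxes
open Literature.MathematicalPhysics.QuantumFieldTheory.Balaban1983to89.B1Eq324BenfattoSect5Eq511
open Literature.MathematicalPhysics.QuantumFieldTheory.Balaban1983to89.B1Eq324BenfattoSect5Eq524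
open Literature.MathematicalPhysics.QuantumFieldTheory.Balaban1983to89.B1Eq324BenfattoAppendixC2
open Literature.MathematicalPhysics.QuantumFieldTheory.Balaban1983to89.B1Eq324BenfattoMarkov
open Literature.MathematicalPhysics.QuantumFieldTheory.Balaban1983to89.B1Eq324BenfattoSect5CondToFree

variable {d : ℕ}

/-! ## §1  `ℓ¹` geometry of the frames -/

section L1

variable {L : ℕ} {m : B1Eq324BenfattoLemma.Site d}

/-- kernel: an integer coordinate difference of at least `n` gives `ℓ¹ ≥ n`. [folklore] -/
private theorem le_l1_of_coord {x y : B1Eq324BenfattoLemma.Site d} {k : Fin d} {n : ℕ}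
    (h : (n : ℤ) ≤ x k - y k ∨ (n : ℤ) ≤ y k - x k) : (n : ℝ) ≤ ∑ j, |((x j : ℝ) - (y j : ℝ))| := by
  refine le_trans ?_ (Finset.single_le_sum (f := fun j => |((x j : ℝ) - (y j : ℝ))|) (fun j _ => abs_nonneg _) (Finset.mem_univ k))
  rcases h with h | h
  · have h' : (n : ℝ) ≤ (x k : ℝ) - (y k : ℝ) := by exact_mod_cast h
    exact h'.trans (le_abs_self _)
  · have h' : (n : ℝ) ≤ (y k : ℝ) - (x k : ℝ) := by exact_mod_cast h
    rw [abs_sub_comm]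
    exact h'.trans (le_abs_self _)

/-- **`ℓ¹` separation across a corridor, general form**: a site at depth `≥ j + v` of the tessera and a site NOT at depth `≥ j` differ by at
least `v + 1` in some coordinate, so `ℓ¹ ≥ v + 1`. [cite: BenfattoEtAl1978, (5.7) p.154, (5.27) p.157] -/
theorem le_l1_of_mem_shrink_of_not_mem_shrink {j v : ℕ} {x y : B1Eq324BenfattoLemma.Site d}
    (hx : x ∈ shrink L m (j + v)) (hy : y ∉ shrink L m j) : (v : ℝ) + 1 ≤ ∑ k, |((x k : ℝ) - (y k : ℝ))| := by
  rw [mem_shrink_iff] at hx hy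
  push Not at hy
  obtain ⟨k, hk⟩ := hy
  obtain ⟨hx1, hx2⟩ := hx k
  push_cast at hx1 hx2
  have h := le_l1_of_coord (x := x) (y := y) (k := k) (n := v + 1) ?_
  · exact_mod_cast h
  by_cases h1 : m k * (L : ℤ) + j ≤ y k
  · have h2 := hk h1
    right; push_cast; linarith
  · push Not at h1
    left; push_cast; linarith

/-- **A site at depth `≥ k` of `□` and a site outside `□` have `ℓ¹ ≥ k + 1`** (across `Γ₁(□)`). [cite: BenfattoEtAl1978, (5.7) p.154] -/
theorem le_l1_of_mem_shrink_of_not_mem_box {k : ℕ} {x y : B1Eq324BenfattoLemma.Site d}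
    (hx : x ∈ shrink L m k) (hy : y ∉ box L m) : (k : ℝ) + 1 ≤ ∑ j, |((x j : ℝ) - (y j : ℝ))| := by
  rw [← shrink_zero] at hy
  have hx' : x ∈ shrink L m (0 + k) := by rwa [zero_add]
  exact le_l1_of_mem_shrink_of_not_mem_shrink hx' hy

/-- **The separation App. D needs at (5.29)**: a leg of `Ψ″₁` in `□′ ∖ Γ₄(□) = shrink (2w + v)` and a leg outside `□′` (e.g. of `Ψ₂`, in
`Γ₁(□) ∪ Γ₂(□)`) have `ℓ¹ ≥ v + 1` — print's «ρ ≥ ½b^{3/2}» across `Γ₄(□)`. [cite: BenfattoEtAl1978, (5.27)–(5.29) p.157] -/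
theorem le_l1_core_sdiff_frame4_of_not_mem_core {w v : ℕ} {x y : B1Eq324BenfattoLemma.Site d}
    (hx : x ∈ core L w m \ frame4 L w v m) (hy : y ∉ core L w m) : (v : ℝ) + 1 ≤ ∑ j, |((x j : ℝ) - (y j : ℝ))| := by
  rw [core_sdiff_frame4] at hx
  rw [core] at hy
  exact le_l1_of_mem_shrink_of_not_mem_shrink hx hy

/-- A leg in `Γ₁(□) ∪ Γ₂(□)` is not in `□′`. [cite: BenfattoEtAl1978, (5.7) p.154] -/
theorem not_mem_core_of_mem_frame1_union_frame2 {w : ℕ} {y : B1Eq324BenfattoLemma.Site d} (hy : y ∈ frame1 L w m ∪ frame2 L w m) :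
    y ∉ core L w m := fun hc => by
  rcases Finset.mem_union.mp hy with h | h
  · exact Finset.disjoint_left.mp (disjoint_core_frame1 L w m) hc h
  · exact Finset.disjoint_left.mp (disjoint_core_frame2 L w m) hc h

/-- **`□′` is `≥ w + 1` from `Γ₁` in `ℓ¹`**: a site of `□′ = shrink 2w` and a site of print's corridor network `Γ₁ = corridors L w B` (which
misses `□′ ∪ Γ₂(□) = shrink w`, `L ≥ 1`) have `ℓ¹ ≥ w + 1`. [cite: BenfattoEtAl1978, (5.7)–(5.8) p.154–155] -/
theorem le_l1_core_of_mem_corridors (hL : 0 < L) {w : ℕ} {B : Finset (B1Eq324BenfattoLemma.Site d)} {x c : B1Eq324BenfattoLemma.Site d}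
    (hx : x ∈ core L w m) (hc : c ∈ corridors L w B) : (w : ℝ) + 1 ≤ ∑ j, |((x j : ℝ) - (c j : ℝ))| := by
  have hc' : c ∉ shrink L m w := fun h => Finset.disjoint_left.mp (disjoint_corridors_shrink hL w B m) hc h
  have hx' : x ∈ shrink L m (w + w) := by rw [← two_mul]; exact hx
  exact le_l1_of_mem_shrink_of_not_mem_shrink hx' hc'

/-- **«intra-cluster ℓ¹ vs cube distance»**: `ℓ¹(x, y) ≤ √d·cubeDist(x, y) + d` (each coordinate gap exceeds `|x_j − y_j| − 1`;
`B1Eq324BenfattoConnLength.sum_gap_le_sqrt_mul_cubeDist`). [cite: BenfattoEtAl1978, after (2.3) p.146] -/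
theorem l1_le_sqrt_mul_cubeDist_add (x y : B1Eq324BenfattoLemma.Site d) :
    ∑ j, |((x j : ℝ) - (y j : ℝ))| ≤ Real.sqrt d * cubeDist x y + d := by
  have h := sum_gap_le_sqrt_mul_cubeDist x y
  have h1 : ∀ j : Fin d, |((x j : ℝ) - (y j : ℝ))| ≤ max (|((x j : ℝ) - (y j : ℝ))| - 1) 0 + 1 := fun j => by
    have := le_max_left (|((x j : ℝ) - (y j : ℝ))| - 1) 0
    linarith
  calc ∑ j, |((x j : ℝ) - (y j : ℝ))| ≤ ∑ j, (max (|((x j : ℝ) - (y j : ℝ))| - 1) 0 + 1) := Finset.sum_le_sum fun j _ => h1 j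
    _ = ∑ j, max (|((x j : ℝ) - (y j : ℝ))| - 1) 0 + d := by
        rw [Finset.sum_add_distrib, Finset.sum_const, Finset.card_univ, Fintype.card_fin, nsmul_eq_mul, mul_one]
    _ ≤ Real.sqrt d * cubeDist x y + d := by linarith

/-- **«intra-cluster ℓ¹ vs connLength»**: two tesserae of one tuple have `ℓ¹(Δ_a, Δ_b) ≤ √d·d(Δ₁…Δ_p) + d` — the coefficient decay
`e^{−(ϰ/2)d(Δ)}` of (4.5) controls the `ℓ¹` spread of a monomial's legs (App. D's same-cluster term).
[cite: BenfattoEtAl1978, (4.5) p.152 and Appendix D p.166] -/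
theorem l1_le_sqrt_mul_connLength_add {p : ℕ} (Δ : Fin p → B1Eq324BenfattoLemma.Site d) (a b : Fin p) :
    ∑ j, |((Δ a j : ℝ) - (Δ b j : ℝ))| ≤ Real.sqrt d * connLength Δ + d := by
  refine (l1_le_sqrt_mul_cubeDist_add (Δ a) (Δ b)).trans ?_
  have := cubeDist_le_connLength Δ a b
  have hd : 0 ≤ Real.sqrt d := Real.sqrt_nonneg _
  nlinarith

end L1

/-! ## §2  The supplier `η` of `…Sect5CondToFree` at depth `k` inside the corridor: `η = C₀₀·θ^k` -/

section Eta

variable {α β : ℝ} {L : ℕ} {m : B1Eq324BenfattoLemma.Site d}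

/-- `0 ≤ θ = 2d/(2d + α²)`. [cite: BenfattoEtAl1978, Appendix C (C.2) p.164] -/
theorem decayRatio_nonneg (d : ℕ) (α : ℝ) : (0 : ℝ) ≤ 2 * d / (2 * d + α ^ 2) := by positivity

/-- `θ = 2d/(2d + α²) ≤ 1`. [cite: BenfattoEtAl1978, Appendix C (C.2) p.164] -/
theorem decayRatio_le_one (d : ℕ) {α : ℝ} (hα : 0 < α) : (2 * d / (2 * d + α ^ 2) : ℝ) ≤ 1 := by
  have h2 : (0 : ℝ) < 2 * d + α ^ 2 := by positivity
  rw [div_le_one h2]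
  nlinarith [pow_pos hα 2]

/-- The `ℓ¹` distance as a natural number: `Σ_j |x_j − y_j| = Σ_j |x_j − y_j|_ℕ` (cast identity). [folklore] -/
private theorem l1_eq_natAbs (x y : B1Eq324BenfattoLemma.Site d) :
    (∑ j, |((x j : ℝ) - (y j : ℝ))|) = ((∑ j, (x j - y j).natAbs : ℕ) : ℝ) := by
  push_cast
  refine Finset.sum_congr rfl fun j _ => ?_
  rw [← Int.cast_sub, Nat.cast_natAbs, Int.cast_abs]

/-- **(C.2) at a given `ℓ¹` separation**: `C(x, y) ≤ C₀₀·θ^n` whenever `n ≤ ℓ¹(x, y)` (`B1Eq324BenfattoAppendixC2.freeCov_le_self_mul_pow_l1`,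
`θ ≤ 1`). [cite: BenfattoEtAl1978, Appendix C (C.2) p.164] -/
theorem freeCov_le_of_le_l1 (hα : 0 < α) (hβ : 0 < β) {x y : B1Eq324BenfattoLemma.Site d} {n : ℕ}
    (hn : (n : ℝ) ≤ ∑ j, |((x j : ℝ) - (y j : ℝ))|) :
    freeCov d α β x y ≤ freeCov d α β 0 0 * (2 * d / (2 * d + α ^ 2)) ^ n := by
  refine (freeCov_le_self_mul_pow_l1 hα hβ x y).trans (mul_le_mul_of_nonneg_left ?_ (freeCov_nonneg hα hβ 0 0))
  rw [l1_eq_natAbs] at hn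
  exact pow_le_pow_of_le_one (decayRatio_nonneg d α) (decayRatio_le_one d hα) (by exact_mod_cast hn)

/-- Moving one endpoint by a lattice vector `e` changes `ℓ¹` by at most `Σ_j |e_j|`. [folklore] -/
private theorem l1_sub_le_l1_add (x c e : B1Eq324BenfattoLemma.Site d) :
    (∑ j, |((x j : ℝ) - (c j : ℝ))|) - ∑ j, |((e j : ℝ))| ≤ ∑ j, |((x j : ℝ) - ((c + e) j : ℝ))| := by
  rw [← Finset.sum_sub_distrib]
  refine Finset.sum_le_sum fun j _ => ?_
  have h := abs_sub_abs_le_abs_sub ((x j : ℝ) - (c j : ℝ)) (e j : ℝ)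
  have e1 : (((c + e) j : ℤ) : ℝ) = (c j : ℝ) + (e j : ℝ) := by push_cast [Pi.add_apply]; ring
  rw [e1, ← sub_sub]
  exact h

/-- `Σ_j |(e_μ)_j| = 1`. [folklore] -/
private theorem sum_abs_unitVec (μ : Fin d) : ∑ j, |(((unitVec μ : ZSite d) j : ℤ) : ℝ)| = 1 := by
  have h : ∀ j : Fin d, |(((unitVec μ : ZSite d) j : ℤ) : ℝ)| = if j = μ then (1 : ℝ) else 0 := by
    intro j
    simp only [unitVec, Pi.single_apply]
    split_ifs <;> simp
  simp only [h, Finset.sum_ite_eq', Finset.mem_univ, if_true]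

/-- `Σ_j |(−e_μ)_j| = 1`. [folklore] -/
private theorem sum_abs_neg_unitVec (μ : Fin d) : ∑ j, |(((-unitVec μ : ZSite d) j : ℤ) : ℝ)| = 1 := by
  rw [← sum_abs_unitVec (d := d) μ]
  refine Finset.sum_congr rfl fun j _ => ?_
  rw [Pi.neg_apply, Int.cast_neg, abs_neg]

/-- **The free covariance from a deep site to the neighbours of a corridor site**: `x` at depth `≥ w + k` of `□`, `c` NOT at depth `≥ w`
(e.g. `c ∈ Γ₁`) ⇒ `C(x, c ± e_μ) ≤ C₀₀·θ^k` (`ℓ¹(x, c) ≥ k + 1`, one step costs `1`). [cite: BenfattoEtAl1978, p.153; Appendix C (C.2) p.164] -/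
theorem freeCov_nbr_le_of_mem_shrink (hα : 0 < α) (hβ : 0 < β) {w k : ℕ} {x c : B1Eq324BenfattoLemma.Site d}
    (hx : x ∈ shrink L m (w + k)) (hc : c ∉ shrink L m w) (μ : Fin d) :
    freeCov d α β x (c + unitVec μ) ≤ freeCov d α β 0 0 * (2 * d / (2 * d + α ^ 2)) ^ k ∧
    freeCov d α β x (c - unitVec μ) ≤ freeCov d α β 0 0 * (2 * d / (2 * d + α ^ 2)) ^ k := by
  have hl1 : (k : ℝ) + 1 ≤ ∑ j, |((x j : ℝ) - (c j : ℝ))| := le_l1_of_mem_shrink_of_not_mem_shrink hx hc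
  constructor
  · refine freeCov_le_of_le_l1 hα hβ ?_
    have h := l1_sub_le_l1_add x c (unitVec μ)
    rw [sum_abs_unitVec] at h
    linarith
  · refine freeCov_le_of_le_l1 hα hβ ?_
    have h := l1_sub_le_l1_add x c (-unitVec μ)
    rw [sum_abs_neg_unitVec, ← sub_eq_add_neg] at h
    linarith

/-- **THE HYPOTHESIS `hη` OF `…Sect5CondToFree` DISCHARGED BY THE GEOMETRY**: for a conditioning region `Γ` missing `□′∪Γ₂(□) = shrink w`
(e.g. `Γ₁`) and a leg `x` at depth `≥ w + k`, the Dirichlet covariance from `x` to every neighbour of `Γ` is `≤ η = C₀₀·θ^k` ((C.6) then (C.2)).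
[cite: BenfattoEtAl1978, p.153; Appendix C (C.2), (C.6) p.164] -/
theorem condCov_nbrs_le_of_mem_shrink (hα : 0 < α) (hβ : 0 < β) {w k : ℕ} {Γ : Finset (B1Eq324BenfattoLemma.Site d)}
    (hΓ : Disjoint Γ (shrink L m w)) {x : B1Eq324BenfattoLemma.Site d} (hx : x ∈ shrink L m (w + k)) :
    ∀ c ∈ Γ, ∀ μ : Fin d,
      condCov (freeCov d α β) Γ x (c + unitVec μ) ≤ freeCov d α β 0 0 * (2 * d / (2 * d + α ^ 2)) ^ k ∧
      condCov (freeCov d α β) Γ x (c - unitVec μ) ≤ freeCov d α β 0 0 * (2 * d / (2 * d + α ^ 2)) ^ k :=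
  condCov_nbrs_le_of_freeCov_le hα hβ Γ x fun _ hc μ =>
    freeCov_nbr_le_of_mem_shrink hα hβ hx (fun h => Finset.disjoint_left.mp hΓ hc h) μ

end Eta

/-! ## §3  The volume-uniform bound on the conditional centre inside a box (Markov localisation + (C.7) + (C.2)) -/

section Centre

variable {α β : ℝ} {L : ℕ} {m : B1Eq324BenfattoLemma.Site d}

/-- A lattice neighbour of a site at depth `≥ w ≥ 1` of `□` lies in `□`. [cite: BenfattoEtAl1978, (5.7) p.154] -/
theorem nbr_mem_box_of_mem_shrink {w : ℕ} (hw : 1 ≤ w) {y : B1Eq324BenfattoLemma.Site d} (hy : y ∈ shrink L m w) (μ : Fin d) :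
    y + unitVec μ ∈ box L m ∧ y - unitVec μ ∈ box L m := by
  rw [mem_shrink_iff] at hy
  rw [mem_box_iff, mem_box_iff]
  have hw' : (1 : ℤ) ≤ w := by exact_mod_cast hw
  constructor
  · intro i
    obtain ⟨h1, h2⟩ := hy i
    simp only [Pi.add_apply, unitVec, Pi.single_apply]
    split_ifs <;> constructor <;> linarith
  · intro i
    obtain ⟨h1, h2⟩ := hy i
    simp only [Pi.sub_apply, unitVec, Pi.single_apply]
    split_ifs <;> constructor <;> linarith

/-- **A site of `Γ` adjacent to `□′∪Γ₂(□)` lies in `Γ₁(□)`** (for `Γ` missing `□′∪Γ₂(□)`, `w ≥ 1`): the only conditioning sites that see the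
inside of the box are those of its own outer corridor. [cite: BenfattoEtAl1978, (5.7) p.154, (5.13) p.155] -/
theorem mem_frame1_of_adjacent {w : ℕ} (hw : 1 ≤ w) {Γ : Finset (B1Eq324BenfattoLemma.Site d)} (hΓ : Disjoint Γ (shrink L m w))
    {c : B1Eq324BenfattoLemma.Site d} (hc : c ∈ Γ)
    (hadj : ∃ μ : Fin d, c + unitVec μ ∈ ((shrink L m w : Finset (B1Eq324BenfattoLemma.Site d)) : Set (B1Eq324BenfattoLemma.Site d)) ∨
      c - unitVec μ ∈ ((shrink L m w : Finset (B1Eq324BenfattoLemma.Site d)) : Set (B1Eq324BenfattoLemma.Site d))) :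
    c ∈ frame1 L w m := by
  obtain ⟨μ, h⟩ := hadj
  rw [frame1, Finset.mem_sdiff]
  refine ⟨?_, fun h' => Finset.disjoint_left.mp hΓ hc h'⟩
  rcases h with h | h
  · have h2 := (nbr_mem_box_of_mem_shrink hw (Finset.mem_coe.mp h) μ).2
    rwa [add_sub_cancel_right] at h2
  · have h2 := (nbr_mem_box_of_mem_shrink hw (Finset.mem_coe.mp h) μ).1
    rwa [sub_add_cancel] at h2

/-- **MARKOV LOCALISATION OF THE CENTRE**: for `Γ ⊇ Γ₁(□)` missing `□′∪Γ₂(□) = shrink w` (`w ≥ 1`) and `x ∈ □′∪Γ₂(□)`, the conditional centre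
`u(x)` depends on the data `z̄` only through `z̄|Γ₁(□)`: `u_{z̄}(x) = u_{z̄·1_{Γ₁(□)}}(x)` (`…Markov.condMean_freeCov_congr_of_enclosed` with the
enclosure `…Sect5Boxes.shrink_enclosed`). [cite: BenfattoEtAl1978, (5.13) p.155; Appendix C (C.7) p.164] -/
theorem condMean_eq_condMean_frame1 (hα : 0 < α) (hβ : 0 < β) {w : ℕ} (hw : 1 ≤ w) {Γ : Finset (B1Eq324BenfattoLemma.Site d)}
    (hΓ1 : frame1 L w m ⊆ Γ) (hΓ : Disjoint Γ (shrink L m w)) (zbar : B1Eq324BenfattoLemma.Site d → ℝ)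
    {x : B1Eq324BenfattoLemma.Site d} (hx : x ∈ shrink L m w) :
    condMean (freeCov d α β) Γ zbar x = condMean (freeCov d α β) Γ (fun c => if c ∈ frame1 L w m then zbar c else 0) x := by
  classical
  refine condMean_freeCov_congr_of_enclosed hα hβ Γ
    (Ω := ((shrink L m w : Finset (B1Eq324BenfattoLemma.Site d)) : Set (B1Eq324BenfattoLemma.Site d)))
    (fun z hz hzΓ => Finset.disjoint_left.mp hΓ hzΓ (Finset.mem_coe.mp hz)) (shrink_enclosed hw m hΓ1) (fun c hc hadj => ?_)
    (Finset.mem_coe.mpr hx)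
  rw [if_pos (mem_frame1_of_adjacent hw hΓ hc hadj)]

/-- **THE CONDITIONAL CENTRE IS EXPONENTIALLY SMALL DEEP INSIDE A BOX, UNIFORMLY IN THE VOLUME**: for `Γ ⊇ Γ₁(□)` missing `□′∪Γ₂(□)` (`w ≥ 1`)
and a leg `x` at depth `≥ w + k`, `|u(x)| ≤ β·(2d·C₀₀θ^k)·Σ_{c∈Γ₁(□)}|z̄_c|`, `θ = 2d/(2d + α²)` — the sum runs over the box's OWN outer corridor
(Markov localisation), not over all of `Γ`; print p. 153 «the covariance of the z_Δ's decays exponentially».  `…Sect5CondToFree.abs_condMean_le_of_condCov_le`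
with `hη` discharged by `condCov_nbrs_le_of_mem_shrink`. [cite: BenfattoEtAl1978, p.153; Appendix C (C.2), (C.6), (C.7) p.164] -/
theorem abs_condMean_le_of_mem_shrink (hα : 0 < α) (hβ : 0 < β) {w k : ℕ} (hw : 1 ≤ w) {Γ : Finset (B1Eq324BenfattoLemma.Site d)}
    (hΓ1 : frame1 L w m ⊆ Γ) (hΓ : Disjoint Γ (shrink L m w)) (zbar : B1Eq324BenfattoLemma.Site d → ℝ)
    {x : B1Eq324BenfattoLemma.Site d} (hx : x ∈ shrink L m (w + k)) :
    |condMean (freeCov d α β) Γ zbar x| ≤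
      β * (2 * d * (freeCov d α β 0 0 * (2 * d / (2 * d + α ^ 2)) ^ k)) * ∑ c ∈ frame1 L w m, |zbar c| := by
  classical
  have hxw : x ∈ shrink L m w := shrink_mono L m (Nat.le_add_right w k) hx
  have hxΓ : x ∉ Γ := fun h => Finset.disjoint_left.mp hΓ h hxw
  rw [condMean_eq_condMean_frame1 hα hβ hw hΓ1 hΓ zbar hxw]
  refine (abs_condMean_le_of_condCov_le hα hβ Γ _ hxΓ (condCov_nbrs_le_of_mem_shrink hα hβ hΓ hx)).trans (le_of_eq ?_)
  congr 1
  rw [← Finset.sum_subset hΓ1 (f := fun c => |if c ∈ frame1 L w m then zbar c else 0|) ?_]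
  · exact Finset.sum_congr rfl fun c hc => by rw [if_pos hc]
  · intro c _ hc
    rw [if_neg hc, abs_zero]

/-- `|Γ₁(□)| ≤ L^d`. [cite: BenfattoEtAl1978, (5.7) p.154] -/
theorem card_frame1_le (L w : ℕ) (m : B1Eq324BenfattoLemma.Site d) : (frame1 L w m).card ≤ L ^ d := by
  have h1 : (frame1 L w m).card ≤ (box L m).card := Finset.card_le_card (by rw [frame1]; exact Finset.sdiff_subset)
  have h2 : (box L m).card ≤ L ^ d := by rw [← shrink_zero]; exact card_shrink_le L m 0
  exact h1.trans h2

/-- **The same with a sup bound on the corridor data**: `|z̄_c| ≤ M` on `Γ₁(□)` ⇒ `|u(x)| ≤ β·(2d·C₀₀θ^k)·L^d·M`.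
[cite: BenfattoEtAl1978, p.153; Appendix C (C.7)–(C.8) p.164] -/
theorem abs_condMean_le_of_mem_shrink' (hα : 0 < α) (hβ : 0 < β) {w k : ℕ} (hw : 1 ≤ w) {Γ : Finset (B1Eq324BenfattoLemma.Site d)}
    (hΓ1 : frame1 L w m ⊆ Γ) (hΓ : Disjoint Γ (shrink L m w)) (zbar : B1Eq324BenfattoLemma.Site d → ℝ)
    {x : B1Eq324BenfattoLemma.Site d} (hx : x ∈ shrink L m (w + k)) {M : ℝ} (hM0 : 0 ≤ M) (hM : ∀ c ∈ frame1 L w m, |zbar c| ≤ M) :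
    |condMean (freeCov d α β) Γ zbar x| ≤
      β * (2 * d * (freeCov d α β 0 0 * (2 * d / (2 * d + α ^ 2)) ^ k)) * ((L : ℝ) ^ d * M) := by
  refine (abs_condMean_le_of_mem_shrink hα hβ hw hΓ1 hΓ zbar hx).trans (mul_le_mul_of_nonneg_left ?_ ?_)
  · calc ∑ c ∈ frame1 L w m, |zbar c| ≤ ∑ _c ∈ frame1 L w m, M := Finset.sum_le_sum hM
      _ = (frame1 L w m).card * M := by rw [Finset.sum_const, nsmul_eq_mul]
      _ ≤ (L : ℝ) ^ d * M := mul_le_mul_of_nonneg_right (by exact_mod_cast card_frame1_le L w m) hM0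
  · have := freeCov_nonneg hα hβ (0 : B1Eq324BenfattoLemma.Site d) 0
    have := decayRatio_nonneg d α
    positivity

variable {B : Finset (B1Eq324BenfattoLemma.Site d)}

/-- **On print's corridors `Γ₁`, legs in the core `□′`**: `|u(x)| ≤ β·(2d·C₀₀θ^w)·Σ_{c∈Γ₁(□)}|z̄_c|` for `x ∈ □′`, `□ ∈ B`, `Γ₁ = corridors L w B`
(`L, w ≥ 1`; print `w = b^{3/2}`). [cite: BenfattoEtAl1978, p.153, (5.7)–(5.8) p.154–155] -/
theorem abs_condMean_corridors_le_core (hα : 0 < α) (hβ : 0 < β) (hL : 0 < L) {w : ℕ} (hw : 1 ≤ w) (hm : m ∈ B)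
    (zbar : B1Eq324BenfattoLemma.Site d → ℝ) {x : B1Eq324BenfattoLemma.Site d} (hx : x ∈ core L w m) :
    |condMean (freeCov d α β) (corridors L w B) zbar x| ≤
      β * (2 * d * (freeCov d α β 0 0 * (2 * d / (2 * d + α ^ 2)) ^ w)) * ∑ c ∈ frame1 L w m, |zbar c| := by
  have hx' : x ∈ shrink L m (w + w) := by rw [← two_mul]; exact hx
  exact abs_condMean_le_of_mem_shrink hα hβ hw (frame1_subset_corridors L w hm) (disjoint_corridors_shrink hL w B m) zbar hx'

/-- **On print's corridors `Γ₁`, legs in `□′∖Γ₄(□)`** (the legs of `Ψ″₁`): `|u(x)| ≤ β·(2d·C₀₀θ^{w+v})·Σ_{c∈Γ₁(□)}|z̄_c|`.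
[cite: BenfattoEtAl1978, p.153, (5.27)–(5.31) p.157–158] -/
theorem abs_condMean_corridors_le_deep (hα : 0 < α) (hβ : 0 < β) (hL : 0 < L) {w v : ℕ} (hw : 1 ≤ w) (hm : m ∈ B)
    (zbar : B1Eq324BenfattoLemma.Site d → ℝ) {x : B1Eq324BenfattoLemma.Site d} (hx : x ∈ core L w m \ frame4 L w v m) :
    |condMean (freeCov d α β) (corridors L w B) zbar x| ≤
      β * (2 * d * (freeCov d α β 0 0 * (2 * d / (2 * d + α ^ 2)) ^ (w + v))) * ∑ c ∈ frame1 L w m, |zbar c| := by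
  rw [core_sdiff_frame4] at hx
  have hx' : x ∈ shrink L m (w + (w + v)) := by rw [← add_assoc, ← two_mul]; exact hx
  exact abs_condMean_le_of_mem_shrink hα hβ hw (frame1_subset_corridors L w hm) (disjoint_corridors_shrink hL w B m) zbar hx'

end Centre

/-! ## §4  The conditioned covariance coincides with the free one deep inside a box, up to `θ^k` -/

section Covariance

variable {α β : ℝ} {L : ℕ} {m : B1Eq324BenfattoLemma.Site d}

/-- **(C.5) as a bound on partial sums**: `Σ_{c∈Γ} C(c, y) ≤ ‖C‖ = 1/(α²β)`. [cite: BenfattoEtAl1978, Appendix C (C.5) p.164] -/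
theorem sum_freeCov_le (hα : 0 < α) (hβ : 0 < β) (Γ : Finset (B1Eq324BenfattoLemma.Site d)) (y : B1Eq324BenfattoLemma.Site d) :
    ∑ c ∈ Γ, freeCov d α β c y ≤ 1 / (α ^ 2 * β) := by
  have h := (summable_freeCov (β := β) hα y).sum_le_tsum Γ (fun c _ => freeCov_nonneg hα hβ y c)
  rw [tsum_freeCov hα y] at h
  exact le_trans (le_of_eq (Finset.sum_congr rfl fun c _ => freeCov_comm α β c y)) h

/-- **THE CONDITIONED COVARIANCE COINCIDES WITH THE FREE ONE DEEP INSIDE A BOX**: for `Γ` missing `□′∪Γ₂(□)` and a leg `x` at depth `≥ w + k`,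
for EVERY `y`: `|C(x, y) − C^Γ(x, y)| ≤ 2d·C₀₀·θ^k/α²` — print p. 153 «far from ⋃(∂□), coincides with the unconditional covariance»
(`…Sect5CondToFree.abs_freeCov_sub_condCov_le` + `condCov_nbrs_le_of_mem_shrink` + (C.5)). [cite: BenfattoEtAl1978, p.153; Appendix C (C.2)–(C.7) p.164] -/
theorem abs_freeCov_sub_condCov_le_of_mem_shrink (hα : 0 < α) (hβ : 0 < β) {w k : ℕ} {Γ : Finset (B1Eq324BenfattoLemma.Site d)}
    (hΓ : Disjoint Γ (shrink L m w)) {x : B1Eq324BenfattoLemma.Site d} (hx : x ∈ shrink L m (w + k)) (y : B1Eq324BenfattoLemma.Site d) :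
    |freeCov d α β x y - condCov (freeCov d α β) Γ x y| ≤
      2 * d * freeCov d α β 0 0 * (2 * d / (2 * d + α ^ 2)) ^ k / α ^ 2 := by
  have hxw : x ∈ shrink L m w := shrink_mono L m (Nat.le_add_right w k) hx
  have hxΓ : x ∉ Γ := fun h => Finset.disjoint_left.mp hΓ h hxw
  refine (abs_freeCov_sub_condCov_le hα hβ Γ hxΓ y (condCov_nbrs_le_of_mem_shrink hα hβ hΓ hx)).trans ?_
  have hs := sum_freeCov_le hα hβ Γ y
  have h0 : 0 ≤ β * (2 * d * (freeCov d α β 0 0 * (2 * d / (2 * d + α ^ 2)) ^ k)) := by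
    have := freeCov_nonneg hα hβ (0 : B1Eq324BenfattoLemma.Site d) 0
    have := decayRatio_nonneg d α
    positivity
  calc β * (2 * d * (freeCov d α β 0 0 * (2 * d / (2 * d + α ^ 2)) ^ k)) * ∑ c ∈ Γ, freeCov d α β c y
      ≤ β * (2 * d * (freeCov d α β 0 0 * (2 * d / (2 * d + α ^ 2)) ^ k)) * (1 / (α ^ 2 * β)) := mul_le_mul_of_nonneg_left hs h0
    _ = 2 * d * freeCov d α β 0 0 * (2 * d / (2 * d + α ^ 2)) ^ k / α ^ 2 := by
        field_simp

/-- **On print's corridors, legs in the core**: `|C(x,y) − C^{Γ₁}(x,y)| ≤ 2d·C₀₀·θ^w/α²` for `x ∈ □′`, `□ ∈ B`, any `y` (`L ≥ 1`).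
[cite: BenfattoEtAl1978, p.153, (5.31) p.158] -/
theorem abs_freeCov_sub_condCov_corridors_le_core (hα : 0 < α) (hβ : 0 < β) (hL : 0 < L) {w : ℕ} (B : Finset (B1Eq324BenfattoLemma.Site d))
    {x : B1Eq324BenfattoLemma.Site d} (hx : x ∈ core L w m) (y : B1Eq324BenfattoLemma.Site d) :
    |freeCov d α β x y - condCov (freeCov d α β) (corridors L w B) x y| ≤
      2 * d * freeCov d α β 0 0 * (2 * d / (2 * d + α ^ 2)) ^ w / α ^ 2 := by
  have hx' : x ∈ shrink L m (w + w) := by rw [← two_mul]; exact hx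
  exact abs_freeCov_sub_condCov_le_of_mem_shrink hα hβ (disjoint_corridors_shrink hL w B m) hx' y

/-- **On print's corridors, legs in `□′∖Γ₄(□)`**: `|C(x,y) − C^{Γ₁}(x,y)| ≤ 2d·C₀₀·θ^{w+v}/α²` (any tessera `□_m`, any `y`).
[cite: BenfattoEtAl1978, p.153, (5.31) p.158] -/
theorem abs_freeCov_sub_condCov_corridors_le_deep (hα : 0 < α) (hβ : 0 < β) (hL : 0 < L) {w v : ℕ} (B : Finset (B1Eq324BenfattoLemma.Site d))
    {x : B1Eq324BenfattoLemma.Site d} (hx : x ∈ core L w m \ frame4 L w v m) (y : B1Eq324BenfattoLemma.Site d) :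
    |freeCov d α β x y - condCov (freeCov d α β) (corridors L w B) x y| ≤
      2 * d * freeCov d α β 0 0 * (2 * d / (2 * d + α ^ 2)) ^ (w + v) / α ^ 2 := by
  rw [core_sdiff_frame4] at hx
  have hx' : x ∈ shrink L m (w + (w + v)) := by rw [← add_assoc, ← two_mul]; exact hx
  exact abs_freeCov_sub_condCov_le_of_mem_shrink hα hβ (disjoint_corridors_shrink hL w B m) hx' y

end Covariance

end Literature.MathematicalPhysics.QuantumFieldTheory.Balaban1983to89.B1Eq324BenfattoSect5LegGeometry

end
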